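import Literature.NumberTheory.Automorphic.PlaneLatticesSelfDualAntidiag          -- ★ p841260 (β3′) antidiagonal self-duality (+ ★ (β1) p841196, ★ (L5-a), ★ (L5-b))
import Literature.NumberTheory.Automorphic.SelfDualStableLatticeCountNormalized    -- ★ p840741 (L5-d3): `exists_mem_glInt_coe_eq_formCongr_of_span_eq` (self-duality is a property of the lattice)
import HarnessLib

/-!
# The self-dual companion-stable plane lattices, stratified: membership in `S(!![0, β; σβ, 0], C(t,d))` in Hermite coordinates, and the
# «completing the square» reduction of the norm condition (type (2) H-side count, Flicker 1998 p. 97)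

Topic `NumberTheory/Automorphic`; namespace `Literature.NumberTheory.Automorphic`.  THEOREMS ONLY (no definition, no instance, no notation, no named fact,
no `sorry`).  Cell `pub/hodgecm-mathlib`, F0∕P3a road «D-N7-inert» ∕ MAP v3 (F11-d): brick **(β2′-i)** of the TYPE-(2) H-side value (B-p10 (g24) plan 05:01Z).
HC_CM is proved only modulo the printed citations until rung 0 closes; this file is unconditional and elementary.

SETTING.  `F` a discretely valued field (`[IsDiscreteValuationRing 𝒪[F]]`, uniformizer `ϖ`), `σ : F →+* F` fixing `ϖ` and isometric; in the ISOTROPIC CYCLIC FRAME of a type-(2)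
element the form is `H = !![0, β; σβ, 0]` with `|β| = |ϖ^e|`, `e ∈ {0,1}`, and the element is the companion matrix `C = !![0, −d; 1, t]`, `|d| = 1`, `t ∈ 𝒪`,
`|t² − 4d| = |ϖ^{2N+1}|` (ODD: the splitting field is ramified), `|2| = 1`.

* §1 `exists_valuation_eq_valuation_zpow` (every `x ≠ 0` has `|x| = |ϖ^m|`), `valuation_zpow_le_valuation_zpow_iff`.
* §2 **`norm_condition_iff`** — COMPLETING THE SQUARE: for `y′ ∈ 𝒪`, `ϖ^{−(2k+e)}(y′² + t y′ + d) ∈ 𝒪 ↔ k ≤ N ∧ ϖ^{−(k+e)}(2y′ + t) ∈ 𝒪`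
  (`4(y′² + t y′ + d) = (2y′+t)² − (t² − 4d)`, and an even and an odd power of `ϖ` never cancel).
* §3 **`mem_selfDualStable_antidiag_companion_iff`** — `Λ ∈ S(H, C)` iff `Λ = Λ(T(k, y, −k−e))` with `0 ≤ k ≤ N`, `y′ := ϖ^{k+e} y ∈ 𝒪`, `ϖ^{−(k+e)}(2y′+t) ∈ 𝒪` and
  `ϖ^{−(2k+2e)}(β σy′ + σβ y′) ∈ 𝒪` (★ (L5-a) existence∕uniqueness, ★ (β1), ★ (β3′), §2).

## References
* [Flicker1998UnitaryFL] Y. Z. Flicker, *Elementary proof of the fundamental lemma for a unitary group*, Canad. J. Math. 50 (1998), §6 p. 95 REMARK, p. 97.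
* [Serre1979] J.-P. Serre, *Local Fields*, GTM 67 (1979), Ch. I §1, Ch. II §3.
-/

set_option autoImplicit false

noncomputable section

open scoped ValuativeRel Matrix MatrixGroups
open Matrix ValuativeRel

namespace Literature.NumberTheory.Automorphic

variable {F : Type*} [Field F] [ValuativeRel F] {ϖ : F} (hϖ : IsUniformizingElement ϖ)

/-! ## §1 Discreteness: every value is a power of `|ϖ|` -/

include hϖ in
/-- `|ϖ^a| ≤ |ϖ^b| ↔ b ≤ a`. [cite: Serre1979, Ch. I §1] -/
theorem valuation_zpow_le_valuation_zpow_iff (a b : ℤ) : valuation F (ϖ ^ a) ≤ valuation F (ϖ ^ b) ↔ b ≤ a := by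
  have h0 := hϖ.ne_zero
  have hb : valuation F (ϖ ^ b) ≠ 0 := by rw [Ne, Valuation.zero_iff]; exact zpow_ne_zero b h0
  rw [show (b ≤ a ↔ 0 ≤ a - b) from sub_nonneg.symm, ← zpow_uniformizer_mem_integer_iff hϖ (a - b), Valuation.mem_integer_iff,
    zpow_sub₀ h0, map_div₀, div_le_one₀ ((Valuation.pos_iff _).2 (zpow_ne_zero b h0))]

include hϖ in
/-- **Every non-zero element has the valuation of a power of the uniformizer** (`𝒪[F]` a discrete valuation ring with `𝔪 = (ϖ)`). [cite: Serre1979, Ch. I §1, Ch. II §3] -/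
theorem exists_valuation_eq_valuation_zpow [IsDiscreteValuationRing 𝒪[F]] {x : F} (hx : x ≠ 0) : ∃ m : ℤ, valuation F x = valuation F (ϖ ^ m) := by
  have h0 := hϖ.ne_zero
  have hirr : Irreducible (⟨ϖ, hϖ.mem⟩ : 𝒪[F]) := (IsDiscreteValuationRing.irreducible_iff_uniformizer _).2 hϖ.span_eq
  -- integral case
  have hint : ∀ z : F, z ≠ 0 → z ∈ 𝒪[F] → ∃ m : ℤ, valuation F z = valuation F (ϖ ^ m) := fun z hz hzO => by
    have hz' : (⟨z, hzO⟩ : 𝒪[F]) ≠ 0 := fun h => hz (congrArg Subtype.val h)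
    obtain ⟨n, u, hu⟩ := IsDiscreteValuationRing.associated_pow_irreducible hz' hirr
    refine ⟨n, ?_⟩
    have hzu : z = (ϖ ^ n) * ((u⁻¹ : (𝒪[F])ˣ) : 𝒪[F]) := by
      have h := congrArg (fun w : 𝒪[F] => ((w * ((u⁻¹ : (𝒪[F])ˣ) : 𝒪[F]) : 𝒪[F]) : F)) hu
      simp only [Units.mul_inv_cancel_right, Subring.coe_mul, SubmonoidClass.coe_pow] at h
      exact h
    have hu1 : valuation F (((u⁻¹ : (𝒪[F])ˣ) : 𝒪[F]) : F) = 1 :=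
      (Valuation.integer.integers (valuation F)).isUnit_iff_valuation_eq_one.1 (Units.isUnit u⁻¹)
    rw [hzu, map_mul, hu1, mul_one, zpow_natCast]
  by_cases hxO : x ∈ 𝒪[F]
  · exact hint x hx hxO
  · -- `x⁻¹ ∈ 𝒪`
    have hxi : x⁻¹ ∈ 𝒪[F] := by
      rw [Valuation.mem_integer_iff] at hxO ⊢
      rw [map_inv₀]; exact inv_le_one_of_one_le₀ (le_of_not_ge hxO)
    obtain ⟨m, hm⟩ := hint x⁻¹ (inv_ne_zero hx) hxi
    refine ⟨-m, ?_⟩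
    rw [_root_.zpow_neg, map_inv₀, ← hm, map_inv₀, inv_inv]

/-! ## §2 Completing the square: the norm condition -/

include hϖ in
/-- **COMPLETING THE SQUARE.**  `|2| = 1`, `t ∈ 𝒪`, `|t² − 4d| = |ϖ^{2N+1}|` (odd), `y′ ∈ 𝒪`, `e ≤ 1`: `ϖ^{−(2k+e)}(y′² + t y′ + d) ∈ 𝒪 ↔ k ≤ N ∧ ϖ^{−(k+e)}(2y′ + t) ∈ 𝒪`
— since `4(y′² + ty′ + d) = (2y′+t)² − (t² − 4d)` and the two terms have valuations `|ϖ|^{even}` ≠ `|ϖ|^{2N+1}`, the valuation of the difference is the larger one.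
[cite: Flicker1998UnitaryFL, §6 p. 97] [cite: Serre1979, Ch. I §1] -/
theorem norm_condition_iff [IsDiscreteValuationRing 𝒪[F]] (h2 : valuation F 2 = 1) {t d : F} (ht : t ∈ 𝒪[F]) {N : ℕ}
    (hD : valuation F (t ^ 2 - 4 * d) = valuation F (ϖ ^ (2 * N + 1))) {k e : ℕ} (he : e ≤ 1) {y' : F} (hy' : y' ∈ 𝒪[F]) :
    ϖ ^ (-((2 * k + e : ℕ) : ℤ)) * (y' ^ 2 + t * y' + d) ∈ 𝒪[F] ↔ k ≤ N ∧ ϖ ^ (-((k + e : ℕ) : ℤ)) * (2 * y' + t) ∈ 𝒪[F] := by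
  have h0 := hϖ.ne_zero
  have h4 : valuation F 4 = 1 := by rw [show (4 : F) = 2 * 2 by norm_num, map_mul, h2, mul_one]
  have hsq : 4 * (y' ^ 2 + t * y' + d) = (2 * y' + t) ^ 2 - (t ^ 2 - 4 * d) := by ring
  have hD' : valuation F (t ^ 2 - 4 * d) = valuation F (ϖ ^ (((2 * N + 1 : ℕ)) : ℤ)) := by rw [zpow_natCast]; exact hD
  -- `|ϖ^{-n} z| ≤ 1 ↔ |z| ≤ |ϖ^n|`
  have key : ∀ (n : ℕ) (z : F), ϖ ^ (-(n : ℤ)) * z ∈ 𝒪[F] ↔ valuation F z ≤ valuation F (ϖ ^ (n : ℤ)) := fun n z => by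
    rw [Valuation.mem_integer_iff, map_mul, _root_.zpow_neg, map_inv₀, ← div_eq_inv_mul, div_le_one₀ ((Valuation.pos_iff _).2 (zpow_ne_zero _ h0))]
  rw [key, key]
  have hval4 : valuation F (y' ^ 2 + t * y' + d) = valuation F ((2 * y' + t) ^ 2 - (t ^ 2 - 4 * d)) := by
    rw [← hsq, map_mul, h4, one_mul]
  rw [hval4]
  by_cases hs : 2 * y' + t = 0
  · -- degenerate: `(2y′+t) = 0`
    rw [hs, zero_pow two_ne_zero, zero_sub, Valuation.map_neg, hD', map_zero, valuation_zpow_le_valuation_zpow_iff hϖ]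
    refine ⟨fun h => ⟨by omega, zero_le⟩, fun h => by push_cast; omega⟩
  · obtain ⟨m, hm⟩ := exists_valuation_eq_valuation_zpow hϖ hs
    have hm2 : valuation F ((2 * y' + t) ^ 2) = valuation F (ϖ ^ (2 * m)) := by rw [map_pow, hm, ← map_pow, ← zpow_natCast, ← _root_.zpow_mul, mul_comm]; rfl
    -- `m ≥ 0` since `2y′ + t ∈ 𝒪`
    have hm0 : 0 ≤ m := by
      have : valuation F (2 * y' + t) ≤ 1 := (Valuation.mem_integer_iff _ _).1
        ((𝒪[F]).add_mem ((𝒪[F]).mul_mem ((Valuation.mem_integer_iff _ _).2 h2.le) hy') ht)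
      rw [hm, show (1 : ValueGroupWithZero F) = valuation F (ϖ ^ (0 : ℤ)) by rw [zpow_zero, map_one],
        valuation_zpow_le_valuation_zpow_iff hϖ] at this
      exact this
    -- no cancellation: `|(2y′+t)² − D| = max`
    have hne : valuation F ((2 * y' + t) ^ 2) ≠ valuation F (t ^ 2 - 4 * d) := by
      rw [hm2, hD']
      intro h
      have h1 := (valuation_zpow_le_valuation_zpow_iff hϖ _ _).1 h.le
      have h2' := (valuation_zpow_le_valuation_zpow_iff hϖ _ _).1 h.ge
      omega
    have hmax : valuation F ((2 * y' + t) ^ 2 - (t ^ 2 - 4 * d)) = max (valuation F ((2 * y' + t) ^ 2)) (valuation F (t ^ 2 - 4 * d)) := by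
      rw [sub_eq_add_neg, Valuation.map_add_of_distinct_val _ (by rwa [Valuation.map_neg]), Valuation.map_neg]
    rw [hmax, max_le_iff, hm2, hD', hm, valuation_zpow_le_valuation_zpow_iff hϖ, valuation_zpow_le_valuation_zpow_iff hϖ,
      valuation_zpow_le_valuation_zpow_iff hϖ]
    constructor
    · rintro ⟨ha, hb⟩
      exact ⟨by push_cast at hb; omega, by push_cast at ha ⊢; omega⟩
    · rintro ⟨hk, hb⟩
      exact ⟨by push_cast at hb ⊢; omega, by push_cast; omega⟩

/-! ## §3 Membership in `S(!![0, β; σβ, 0], C)` through the strata `k` -/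

section Strata

variable (σ : F →+* F)

omit [ValuativeRel F] in
/-- Rescaling identities at `l = −k − e`, `y′ = ϖ^{−l} y`: the norm and trace expressions of ★ (β1) ∕ ★ (β3′) in the `y′`-coordinate. [cite: Flicker1998UnitaryFL, §6 p. 97] -/
theorem companion_rescale_identities (hϖ0 : ϖ ≠ 0) {k : ℕ} {e : ℕ} {l : ℤ} (hl : l = -(k : ℤ) - e) (y t d β sβ sy : F) :
    ϖ ^ (-((k : ℤ) + l)) * (y ^ 2 + t * y * ϖ ^ l + d * ϖ ^ (2 * l)) =
        ϖ ^ (-((2 * k + e : ℕ) : ℤ)) * ((ϖ ^ (-l) * y) ^ 2 + t * (ϖ ^ (-l) * y) + d) ∧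
      ϖ ^ l * (β * sy + sβ * y) = ϖ ^ (-((2 * k + 2 * e : ℕ) : ℤ)) * (β * (ϖ ^ (-l) * sy) + sβ * (ϖ ^ (-l) * y)) := by
  have ha : (ϖ : F) ^ l ≠ 0 := zpow_ne_zero l hϖ0
  have h1 : (ϖ : F) ^ (-((k : ℤ) + l)) = ϖ ^ (e : ℤ) := by rw [hl]; congr 1; ring
  have h2 : (ϖ : F) ^ (2 * l) = (ϖ ^ l) ^ 2 := by rw [mul_comm, _root_.zpow_mul]; norm_cast
  have h3 : (ϖ : F) ^ (-((2 * k + e : ℕ) : ℤ)) = ϖ ^ (e : ℤ) * (ϖ ^ l) ^ 2 := by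
    rw [← h2, ← zpow_add₀ hϖ0, hl]; congr 1; push_cast; ring
  have h3' : (ϖ : F) ^ (-((2 * k + 2 * e : ℕ) : ℤ)) = (ϖ ^ l) ^ 2 := by
    rw [← h2, hl]; congr 1; push_cast; ring
  have h4 : (ϖ : F) ^ (-l) = (ϖ ^ l)⁻¹ := zpow_neg ϖ l
  refine ⟨?_, ?_⟩
  · rw [h1, h2, h3, h4]; field_simp
  · rw [h3', h4]; field_simp

variable [IsDiscreteValuationRing 𝒪[F]]

include hϖ in
/-- **THE EXPONENTS OF A SELF-DUAL `C`-STABLE HERMITE LATTICE**: `l = −k − e` and `0 ≤ k ≤ N`.  (Self-duality for `!![0, β; σβ, 0]` with `|β| = |ϖ^e|` gives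
`|ϖ^{e+k+l}| = 1` (★ (β3′)); `C`-stability gives `l ≤ k` and the norm condition (★ (β1)), which §2 turns into `k ≤ N`.) [cite: Flicker1998UnitaryFL, §6 p. 97] -/
theorem exponents_of_selfDual_companionStable (hσϖ : σ ϖ = ϖ) (hσv : ∀ x, valuation F (σ x) = valuation F x) (h2 : valuation F 2 = 1)
    {t d β : F} (ht : t ∈ 𝒪[F]) (hd : valuation F d = 1) {e : ℕ} (he : e ≤ 1) (hβ : valuation F β = valuation F (ϖ ^ e)) {N : ℕ}
    (hD : valuation F (t ^ 2 - 4 * d) = valuation F (ϖ ^ (2 * N + 1))) {k l : ℤ} {y : F} (γ g : GL (Fin 2) F)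
    (hγ : (γ : Matrix (Fin 2) (Fin 2) F) = !![0, -d; 1, t]) (hg : (g : Matrix (Fin 2) (Fin 2) F) = !![ϖ ^ k, y; 0, ϖ ^ l])
    (hsd : ∃ J' ∈ glInt 2 F, (J' : Matrix (Fin 2) (Fin 2) F) = formCongr σ g (!![0, β; σ β, 0] : Matrix (Fin 2) (Fin 2) F))
    (hst : (Submodule.span 𝒪[F] (Set.range ((g : Matrix (Fin 2) (Fin 2) F))ᵀ)).map
        ((Matrix.toLin' (γ : Matrix (Fin 2) (Fin 2) F)).restrictScalars 𝒪[F]) = Submodule.span 𝒪[F] (Set.range ((g : Matrix (Fin 2) (Fin 2) F))ᵀ)) :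
    ∃ kn : ℕ, k = kn ∧ l = -(kn : ℤ) - e ∧ kn ≤ N := by
  have h0 := hϖ.ne_zero
  obtain ⟨hval, -⟩ := (exists_mem_glInt_coe_eq_formCongr_hermite_antidiag_iff σ hϖ hσϖ hσv g hg).1 hsd
  obtain ⟨hlk, hy, hnorm⟩ := (map_companion_span_eq_self_iff_of_hermite hϖ γ g hγ hd ht hg).1 hst
  -- `|β ϖ^{k+l}| = |ϖ^{e+k+l}| = 1 ⇒ e + k + l = 0`
  have hekl : (e : ℤ) + (k + l) = 0 := by
    rw [map_mul, hβ, ← map_mul, ← zpow_natCast, ← zpow_add₀ h0, valuation_zpow_uniformizer_eq_one_iff hϖ] at hval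
    exact hval
  have hk0 : 0 ≤ k := by omega
  obtain ⟨kn, rfl⟩ := Int.eq_ofNat_of_zero_le hk0
  have hl : l = -(kn : ℤ) - e := by omega
  refine ⟨kn, rfl, hl, ?_⟩
  -- the norm condition in the `y′`-coordinate, then §2
  have hid := (companion_rescale_identities h0 hl y t d β (σ β) (σ y)).1
  rw [hid] at hnorm
  exact ((norm_condition_iff hϖ h2 ht hD he hy).1 hnorm).1

include hϖ in
/-- **MEMBERSHIP THROUGH THE STRATA**: `Λ ∈ S(!![0, β; σβ, 0], C)` iff for some `0 ≤ k ≤ N` it is a SELF-DUAL `C`-STABLE Hermite lattice `Λ(T(k, y, −k−e))`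
(★ (L5-a) existence; self-duality is a property of the lattice, ★ `exists_mem_glInt_coe_eq_formCongr_of_span_eq`; exponents by the previous theorem).
[cite: Flicker1998UnitaryFL, §6 p. 97] [cite: Macdonald1995, Ch. V §2] -/
theorem mem_selfDualStable_antidiag_companion_iff (hσϖ : σ ϖ = ϖ) (hσv : ∀ x, valuation F (σ x) = valuation F x) (hσO : ∀ x : 𝒪[F], σ x ∈ 𝒪[F])
    (h2 : valuation F 2 = 1) {t d β : F} (ht : t ∈ 𝒪[F]) (hd : valuation F d = 1) {e : ℕ} (he : e ≤ 1) (hβ : valuation F β = valuation F (ϖ ^ e))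
    {N : ℕ} (hD : valuation F (t ^ 2 - 4 * d) = valuation F (ϖ ^ (2 * N + 1))) (γ : GL (Fin 2) F)
    (hγ : (γ : Matrix (Fin 2) (Fin 2) F) = !![0, -d; 1, t]) (Λ : Submodule 𝒪[F] (Fin 2 → F)) :
    Λ ∈ {Λ : Submodule 𝒪[F] (Fin 2 → F) |
        (∃ g : GL (Fin 2) F, (∃ J' ∈ glInt 2 F, (J' : Matrix (Fin 2) (Fin 2) F) = formCongr σ g (!![0, β; σ β, 0] : Matrix (Fin 2) (Fin 2) F)) ∧
          Λ = Submodule.span 𝒪[F] (Set.range ((g : Matrix (Fin 2) (Fin 2) F))ᵀ)) ∧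
        Λ.map ((Matrix.toLin' (γ : Matrix (Fin 2) (Fin 2) F)).restrictScalars 𝒪[F]) = Λ} ↔
      ∃ k : ℕ, k ≤ N ∧ ∃ (y : F) (g : GL (Fin 2) F), (g : Matrix (Fin 2) (Fin 2) F) = !![ϖ ^ (k : ℤ), y; 0, ϖ ^ (-(k : ℤ) - e)] ∧
        (∃ J' ∈ glInt 2 F, (J' : Matrix (Fin 2) (Fin 2) F) = formCongr σ g (!![0, β; σ β, 0] : Matrix (Fin 2) (Fin 2) F)) ∧
        (Submodule.span 𝒪[F] (Set.range ((g : Matrix (Fin 2) (Fin 2) F))ᵀ)).map ((Matrix.toLin' (γ : Matrix (Fin 2) (Fin 2) F)).restrictScalars 𝒪[F]) =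
          Submodule.span 𝒪[F] (Set.range ((g : Matrix (Fin 2) (Fin 2) F))ᵀ) ∧
        Λ = Submodule.span 𝒪[F] (Set.range ((g : Matrix (Fin 2) (Fin 2) F))ᵀ) := by
  constructor
  · rintro ⟨⟨g₀, hsd₀, rfl⟩, hst⟩
    obtain ⟨k, l, y, g, hg, hΛ⟩ := exists_hermite_span_eq hϖ g₀
    have hsd : ∃ J' ∈ glInt 2 F, (J' : Matrix (Fin 2) (Fin 2) F) = formCongr σ g (!![0, β; σ β, 0] : Matrix (Fin 2) (Fin 2) F) :=
      exists_mem_glInt_coe_eq_formCongr_of_span_eq σ hσO _ hΛ hsd₀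
    rw [hΛ] at hst
    obtain ⟨kn, rfl, rfl, hkN⟩ := exponents_of_selfDual_companionStable hϖ σ hσϖ hσv h2 ht hd he hβ hD γ g hγ hg hsd hst
    exact ⟨kn, hkN, y, g, hg, hsd, hst, hΛ⟩
  · rintro ⟨k, -, y, g, hg, hsd, hst, rfl⟩
    exact ⟨⟨g, hsd, rfl⟩, hst⟩

end Strata

end Literature.NumberTheory.Automorphic

end
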